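import Mathlib
import Summits.Ventures.LatticeQCDFlow.Scaling.U1PlaquetteLayer

/-!
# LatticeQCDFlow / Scaling — `U(1)` slab moments: the plaquette cosine is an eigenfunction of the
# order-four slab kernel with eigenvalue `1/16`

HONEST FRAMING: exact (Metropolis-corrected) sampling algorithms for lattice gauge theory;
figures of merit are autocorrelation/cost numbers at stated couplings and volumes; no
continuum-physics claim.

Venture `LatticeQCDFlow` (cell pub-lqcd), topic `Scaling`, FANOUT row 30 (lean-1) — OUR WORK (LEAD
LINE 230 (G3′)), lattice file 4 of the slab-chain proof of (LC) at every separation.  With the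
centred order-four kernel `rho4` of `Scaling/U1SlabMoments.lean` and the layer plaquette cosine
`xObs` of `Scaling/U1PlaquetteLayer.lean`:
**`integral_xObs_mul_rho4`** — THE EIGENVALUE `∫ xObs(e) ρ(e, e') de = xObs(e')/16`.  Proof:
`∫ xObs(e) slabCost(e,v,e')⁴ de` expands over words `w : Fin 4 → LEdge`; a word missing one edge of
`P` contributes `0` (`integral_xObs_mul_prod_eq_zero_of_miss`: rotate that bond by `−1`, `xObs` flips
sign, the word is unchanged); the `4! = 24` words covering `P` are the permutations of `pedge` and
each contributes `(1/16) Re ∏_k q(pedge k)^{psgn k}` with `q(ℓ) = v(src ℓ) v(tgt ℓ)⁻¹ e'(ℓ)⁻¹`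
(`integral_xObs_mul_prod_pedge`: the law of the four bond variables is Haar on `U(1)⁴`,
`map_pedge_pi`, and the circle integrals `∫ z^{±1} Re(zq) = q^{∓1}/2`, `integral_zpow_mul_re`);
the vertical variables telescope around the closed plaquette (`plaqChar_ratio`), so that real part
is `xObs(e')`; finally `integral_xObs_mul_slabCost_four` (`= (24/16) xObs(e')`), Fubini, and the
centring constant drops by `∫ xObs = 0`.  Elementary; nothing is cited as a fact; no `def`,
no `sorry`.
-/

noncomputable section

open MeasureTheory Filter Finset
open Literature.MathematicalPhysics.QuantumFieldTheory

namespace Summit.Ventures.LatticeQCDFlow.Theory2.Lattice.U1Layer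

variable {d L : ℕ} [NeZero L] {a i j : Fin d}

/-! ## 2. The eigenvalue of the order-four kernel on the plaquette cosine -/

section Eigen

variable (hi : i ≠ a) (hj : j ≠ a) (hij : i ≠ j)

omit [NeZero L] in
/-- The ratio `q(ℓ) = v(src ℓ) v(tgt ℓ)⁻¹ e'(ℓ)⁻¹`: `plaqU e v e' ℓ = e(ℓ) · q(ℓ)`. [folklore] -/
theorem plaqU_eq_mul_ratio (e : LEdge d L a → Circle) (v : LSite d L a → Circle)
    (e' : LEdge d L a → Circle) (ℓ : LEdge d L a) :
    plaqU e v e' ℓ = e ℓ * (v ℓ.src * (v ℓ.tgt)⁻¹ * (e' ℓ)⁻¹) := by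
  simp only [plaqU, mul_comm, mul_left_comm, mul_assoc]

omit [NeZero L] hij in
/-- **The vertical variables telescope around the plaquette**: the plaquette character of the
ratios `q` is the inverse plaquette character of `e'`. [folklore] -/
theorem plaqChar_ratio (v : LSite d L a → Circle) (e' : LEdge d L a → Circle) :
    plaqChar hi hj (fun ℓ => v ℓ.src * (v ℓ.tgt)⁻¹ * (e' ℓ)⁻¹) = (plaqChar hi hj e')⁻¹ := by
  have ht0 : (pedge (L := L) hi hj 0).tgt = usite hi := by
    apply Subtype.ext; simp [LEdge.tgt, pedge, zsite, usite, Site.shift]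
  have ht3 : (pedge (L := L) hi hj 3).tgt = usite hj := by
    apply Subtype.ext; simp [LEdge.tgt, pedge, zsite, usite, Site.shift]
  have ht12 : (pedge (L := L) hi hj 1).tgt = (pedge hi hj 2).tgt := by
    apply Subtype.ext; simp [LEdge.tgt, pedge, usite, Site.shift, add_comm]
  unfold plaqChar
  simp only [Fin.prod_univ_four, psgn, Fin.isValue, zpow_one, zpow_neg]
  simp only [show (0 : Fin 4) = ⟨0, by omega⟩ from rfl, show (1 : Fin 4) = ⟨1, by omega⟩ from rfl,
    show (2 : Fin 4) = ⟨2, by omega⟩ from rfl, show (3 : Fin 4) = ⟨3, by omega⟩ from rfl] at ht0 ht3 ht12 ⊢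
  simp only [LEdge.src, pedge] at ht0 ht3 ht12 ⊢
  rw [ht0, ht3, ht12]
  simp only [mul_inv_rev, inv_inv]
  -- abelian group identity
  simp only [mul_comm, mul_left_comm, mul_assoc, mul_inv_cancel_left, mul_inv_cancel, one_mul]

/-- A circle integral: `∫ z^s Re(z q) dz = q^{-s}/2` for `s = ±1`. [folklore] -/
theorem integral_zpow_mul_re (q : Circle) {s : ℤ} (hs : s = 1 ∨ s = -1) :
    ∫ z : Circle, ((z : ℂ)) ^ s * ((((z * q : Circle) : ℂ)).re : ℂ) ∂(haarProbability Circle) =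
      2⁻¹ * ((q : ℂ)) ^ (-s) := by
  have hq : ((q : ℂ)) ≠ 0 := Circle.coe_ne_zero q
  have hre : ∀ z : Circle, ((((z * q : Circle) : ℂ)).re : ℂ) =
      2⁻¹ * ((z : ℂ) * (q : ℂ) + ((z : ℂ))⁻¹ * ((q : ℂ))⁻¹) := by
    intro z
    rw [re_coe_eq_half_sum, Fintype.sum_bool]
    simp only [sgn, if_true, Bool.false_eq_true, if_false, zpow_one, zpow_neg, Circle.coe_inv,
      Circle.coe_mul, mul_inv_rev]
    ring
  simp_rw [hre]
  have hsplit : ∀ z : Circle, ((z : ℂ)) ^ s * (2⁻¹ * ((z : ℂ) * (q : ℂ) + ((z : ℂ))⁻¹ * ((q : ℂ))⁻¹)) =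
      (2⁻¹ * (q : ℂ)) * ((z : ℂ)) ^ (s + 1) + (2⁻¹ * ((q : ℂ))⁻¹) * ((z : ℂ)) ^ (s - 1) := by
    intro z
    have hz : ((z : ℂ)) ≠ 0 := Circle.coe_ne_zero z
    rw [zpow_add₀ hz, zpow_sub₀ hz, zpow_one]
    ring
  simp_rw [hsplit]
  have hzc : ∀ m : ℤ, Continuous fun z : Circle => ((z : ℂ)) ^ m := fun m =>
    (continuous_subtype_val : Continuous fun z : Circle => (z : ℂ)).zpow₀ m
      fun z => Or.inl (Circle.coe_ne_zero z)
  have hint : ∀ (c : ℂ) (m : ℤ), Integrable (fun z : Circle => c * ((z : ℂ)) ^ m) (haarProbability Circle) :=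
    fun c m => Integrable.of_bound ((continuous_const.mul (hzc m)).aestronglyMeasurable) (‖c‖ * 1)
      (Eventually.of_forall fun z => by
        rw [norm_mul, norm_zpow, Circle.norm_coe, one_zpow])
  rw [integral_add (hint _ _) (hint _ _), integral_const_mul, integral_const_mul,
    Literature.MathematicalPhysics.QuantumLattice.integral_coe_zpow_haarProbability_circle,
    Literature.MathematicalPhysics.QuantumLattice.integral_coe_zpow_haarProbability_circle]
  rcases hs with rfl | rfl
  · norm_num
  · norm_num

include hij in
/-- **A word missing a plaquette edge contributes nothing**: if no letter of `w` is the edge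
`pedge k`, then `∫ xObs(e) ∏_l Re(e(w_l) q_l) de = 0` (rotate the bond `pedge k` by `−1`). [folklore] -/
theorem integral_xObs_mul_prod_eq_zero_of_miss (hL : 2 ≤ L) {m : ℕ} (w : Fin m → LEdge d L a)
    (q : LEdge d L a → Circle) {k : Fin 4} (hk : ∀ l, w l ≠ pedge hi hj k) :
    ∫ e, (xObs hi hj e : ℂ) * ∏ l, ((((e (w l) * q (w l) : Circle) : ℂ)).re : ℂ)
      ∂(Measure.pi fun _ : LEdge d L a => haarProbability Circle) = 0 := by
  set z₀ : Circle := Circle.exp Real.pi with hz₀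
  have hz : (z₀ : ℂ) = -1 := by rw [hz₀, Circle.coe_exp, Complex.exp_pi_mul_I]
  have hzk : ((z₀ : ℂ)) ^ psgn k = -1 := by
    have : psgn k = 1 ∨ psgn k = -1 := by fin_cases k <;> simp [psgn]
    rcases this with h | h <;> rw [h, hz] <;> norm_num
  have hinj := pedge_injective hi hj hij hL
  set g : LEdge d L a → Circle := Pi.mulSingle (pedge hi hj k) z₀ with hg
  set F : (LEdge d L a → Circle) → ℂ :=
    fun e => (xObs hi hj e : ℂ) * ∏ l, ((((e (w l) * q (w l) : Circle) : ℂ)).re : ℂ) with hF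
  have h := integral_mul_left_eq_self (μ := Measure.pi fun _ : LEdge d L a => haarProbability Circle) F g
  have hneg : ∀ e : LEdge d L a → Circle, F (g * e) = -F e := by
    intro e
    have hx : (xObs hi hj (g * e) : ℂ) = -(xObs hi hj e : ℂ) := by
      rw [xObs, xObs, hg, plaqChar_mulSingle hi hj hinj, Circle.coe_mul, Circle.coe_zpow, hzk]
      simp
    have hw : ∀ l, (g * e) (w l) = e (w l) := fun l => by
      rw [Pi.mul_apply, hg, Pi.mulSingle_eq_of_ne (hk l), one_mul]
    simp only [hF, hw, hx]
    ring
  simp_rw [hneg, integral_neg] at h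
  simp only [hF] at h
  have h2 : (2 : ℂ) * ∫ e, (xObs hi hj e : ℂ) * ∏ l, ((((e (w l) * q (w l) : Circle) : ℂ)).re : ℂ)
      ∂(Measure.pi fun _ : LEdge d L a => haarProbability Circle) = 0 := by linear_combination -h
  exact (mul_eq_zero.1 h2).resolve_left two_ne_zero

/-- The law of the four plaquette bond variables under the Haar product is the Haar product on
`U(1)⁴`. [folklore] -/
theorem map_pedge_pi (hinj : Function.Injective (pedge (L := L) hi hj)) :
    (Measure.pi fun _ : LEdge d L a => haarProbability Circle).map
        (fun e (k : Fin 4) => e (pedge hi hj k)) =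
      Measure.pi fun _ : Fin 4 => haarProbability Circle := by
  rw [← Measure.infinitePi_eq_pi, ← Measure.infinitePi_eq_pi]
  exact Measure.map_infinitePi_infinitePi_of_inj (P := fun _ : LEdge d L a => haarProbability Circle) hinj

include hij in
/-- **The covering word contributes `xObs(e')/16`**:
`∫ xObs(e) ∏_k Re(e(pedge k) q(pedge k)) de = (1/16) Re(∏_k q(pedge k)^{psgn k})`. [folklore] -/
theorem integral_xObs_mul_prod_pedge (hL : 2 ≤ L) (q : LEdge d L a → Circle) :
    ∫ e, (xObs hi hj e : ℂ) * ∏ k, ((((e (pedge hi hj k) * q (pedge hi hj k) : Circle) : ℂ)).re : ℂ)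
      ∂(Measure.pi fun _ : LEdge d L a => haarProbability Circle) =
      16⁻¹ * ((((plaqChar hi hj q : Circle) : ℂ)).re : ℂ) := by
  have hinj := pedge_injective hi hj hij hL
  -- transport to the four bond variables
  set G : (Fin 4 → Circle) → ℂ := fun z =>
    ((((∏ k, z k ^ psgn k : Circle) : ℂ)).re : ℂ) *
      ∏ k, ((((z k * q (pedge hi hj k) : Circle) : ℂ)).re : ℂ) with hG
  have hcomp : ∀ e : LEdge d L a → Circle,
      (xObs hi hj e : ℂ) * ∏ k, ((((e (pedge hi hj k) * q (pedge hi hj k) : Circle) : ℂ)).re : ℂ) =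
        G (fun k => e (pedge hi hj k)) := fun e => rfl
  simp_rw [hcomp]
  have hGm : AEStronglyMeasurable G (Measure.pi fun _ : Fin 4 => haarProbability Circle) := by
    refine (Continuous.aestronglyMeasurable ?_)
    simp only [hG]
    refine Continuous.mul ?_ (continuous_finsetProd _ fun k _ => ?_)
    · have h1 : ∀ k, Continuous fun z : Fin 4 → Circle => (z k ^ psgn k : Circle) := fun k => by fun_prop
      have hP1 : Continuous fun z : Fin 4 → Circle => (∏ k, z k ^ psgn k : Circle) :=
        continuous_finsetProd _ fun k _ => h1 k
      exact Complex.continuous_ofReal.comp (Complex.continuous_re.comp (continuous_subtype_val.comp hP1))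
    · refine Complex.continuous_ofReal.comp (Complex.continuous_re.comp (continuous_subtype_val.comp ?_))
      have h1 : Continuous fun z : Fin 4 → Circle => (z k * q (pedge hi hj k) : Circle) := by fun_prop
      exact h1
  rw [← integral_map (measurable_pi_lambda _ fun k => measurable_pi_apply _).aemeasurable
    (by rw [map_pedge_pi hi hj hinj]; exact hGm), map_pedge_pi hi hj hinj]
  -- expand the two real parts of the plaquette character
  have hP : ∀ z : Fin 4 → Circle, ((((∏ k, z k ^ psgn k : Circle) : ℂ)).re : ℂ) =
      2⁻¹ * (∏ k, ((z k : ℂ)) ^ psgn k + ∏ k, ((z k : ℂ)) ^ (-psgn k)) := by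
    intro z
    rw [re_coe_eq_half_sum, Fintype.sum_bool]
    simp only [sgn, if_true, Bool.false_eq_true, if_false, zpow_one, zpow_neg, ← Circle.coeHom_apply,
      map_prod, map_inv, map_zpow]
    simp only [Circle.coeHom_apply, ← Finset.prod_inv_distrib, ← zpow_neg]
  have hsplit : ∀ z : Fin 4 → Circle, G z =
      2⁻¹ * ∏ k, (((z k : ℂ)) ^ psgn k * ((((z k * q (pedge hi hj k) : Circle) : ℂ)).re : ℂ)) +
        2⁻¹ * ∏ k, (((z k : ℂ)) ^ (-psgn k) * ((((z k * q (pedge hi hj k) : Circle) : ℂ)).re : ℂ)) := by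
    intro z
    simp only [hG]
    rw [hP, prod_mul_distrib, prod_mul_distrib]
    ring
  simp_rw [hsplit]
  have hint : ∀ t : Fin 4 → ℤ, Integrable (fun z : Fin 4 → Circle =>
      (2⁻¹ : ℂ) * ∏ k, (((z k : ℂ)) ^ t k * ((((z k * q (pedge hi hj k) : Circle) : ℂ)).re : ℂ)))
      (Measure.pi fun _ : Fin 4 => haarProbability Circle) := by
    intro t
    refine Integrable.of_bound ?_ (2⁻¹ * 1) (Eventually.of_forall fun z => ?_)
    · refine (Continuous.aestronglyMeasurable ?_)
      refine continuous_const.mul (continuous_finsetProd _ fun k _ => Continuous.mul ?_ ?_)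
      · exact ((continuous_subtype_val.comp (continuous_apply k)).zpow₀ (t k)
          fun z => Or.inl (Circle.coe_ne_zero _))
      · have h1 : Continuous fun z : Fin 4 → Circle => (z k * q (pedge hi hj k) : Circle) := by fun_prop
        exact Complex.continuous_ofReal.comp (Complex.continuous_re.comp
          (continuous_subtype_val.comp h1))
    · rw [norm_mul, norm_inv, Complex.norm_ofNat, norm_prod]
      refine mul_le_mul_of_nonneg_left ?_ (by norm_num)
      calc ∏ k, ‖((z k : ℂ)) ^ t k * ((((z k * q (pedge hi hj k) : Circle) : ℂ)).re : ℂ)‖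
          ≤ ∏ _k : Fin 4, (1 : ℝ) := prod_le_prod (fun _ _ => norm_nonneg _) fun k _ => by
            rw [norm_mul, norm_zpow, Circle.norm_coe, one_zpow, one_mul, Complex.norm_real,
              Real.norm_eq_abs]
            exact (Complex.abs_re_le_norm _).trans (le_of_eq (Circle.norm_coe _))
        _ = 1 := by simp
  rw [integral_add (hint _) (hint fun k => -psgn k), integral_const_mul, integral_const_mul,
    integral_fintype_prod_eq_prod (fun k (z : Circle) =>
      ((z : ℂ)) ^ psgn k * ((((z * q (pedge hi hj k) : Circle) : ℂ)).re : ℂ)),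
    integral_fintype_prod_eq_prod (fun k (z : Circle) =>
      ((z : ℂ)) ^ (-psgn k) * ((((z * q (pedge hi hj k) : Circle) : ℂ)).re : ℂ))]
  have hs : ∀ k : Fin 4, psgn k = 1 ∨ psgn k = -1 := fun k => by fin_cases k <;> simp [psgn]
  have hs' : ∀ k : Fin 4, -psgn k = 1 ∨ -psgn k = -1 := fun k => by fin_cases k <;> simp [psgn]
  simp_rw [integral_zpow_mul_re _ (hs _), integral_zpow_mul_re _ (hs' _), neg_neg, prod_mul_distrib,
    prod_const, card_univ, Fintype.card_fin]
  -- the plaquette character of `q`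
  have hq : ((((plaqChar hi hj q : Circle) : ℂ)).re : ℂ) =
      2⁻¹ * (∏ k, ((q (pedge hi hj k) : ℂ)) ^ psgn k + ∏ k, ((q (pedge hi hj k) : ℂ)) ^ (-psgn k)) := by
    rw [plaqChar, hP]
  rw [hq]
  ring

include hij in
/-- **`∫ xObs(e) slabCost(e,v,e')⁴ de = (24/16) xObs(e')`** for all vertical variables `v`. [folklore] -/
theorem integral_xObs_mul_slabCost_four (hL : 2 ≤ L) (v : LSite d L a → Circle)
    (e' : LEdge d L a → Circle) :
    ∫ e, (xObs hi hj e : ℂ) * ((slabCost e v e' : ℝ) : ℂ) ^ 4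
      ∂(Measure.pi fun _ : LEdge d L a => haarProbability Circle) = 24 / 16 * (xObs hi hj e' : ℂ) := by
  set μE := Measure.pi fun _ : LEdge d L a => haarProbability Circle with hμE
  have hinj := pedge_injective hi hj hij hL
  set q : LEdge d L a → Circle := fun ℓ => v ℓ.src * (v ℓ.tgt)⁻¹ * (e' ℓ)⁻¹ with hqdef
  -- expand the fourth power in words
  have hcost : ∀ e : LEdge d L a → Circle, ((slabCost e v e' : ℝ) : ℂ) ^ 4 =
      ∑ w : Fin 4 → LEdge d L a, ∏ l, ((((e (w l) * q (w l) : Circle) : ℂ)).re : ℂ) := by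
    intro e
    unfold slabCost
    rw [← Complex.ofReal_pow, Fintype.sum_pow, Complex.ofReal_sum]
    refine sum_congr rfl fun w _ => ?_
    rw [Complex.ofReal_prod]
    refine prod_congr rfl fun l _ => ?_
    rw [plaqU_eq_mul_ratio]
  simp_rw [hcost, mul_sum]
  -- the summands
  set T : (Fin 4 → LEdge d L a) → ℂ := fun w =>
    ∫ e, (xObs hi hj e : ℂ) * ∏ l, ((((e (w l) * q (w l) : Circle) : ℂ)).re : ℂ) ∂μE with hT
  have hint : ∀ w : Fin 4 → LEdge d L a, Integrable (fun e : LEdge d L a → Circle =>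
      (xObs hi hj e : ℂ) * ∏ l, ((((e (w l) * q (w l) : Circle) : ℂ)).re : ℂ)) μE := by
    intro w
    refine Integrable.of_bound (Continuous.aestronglyMeasurable ?_) (1 * 1)
      (Eventually.of_forall fun e => ?_)
    · refine (Complex.continuous_ofReal.comp (continuous_xObs hi hj)).mul
        (continuous_finsetProd _ fun l _ => ?_)
      have h1 : Continuous fun e : LEdge d L a → Circle => (e (w l) * q (w l) : Circle) := by fun_prop
      exact Complex.continuous_ofReal.comp (Complex.continuous_re.comp (continuous_subtype_val.comp h1))
    · rw [norm_mul, norm_prod, Complex.norm_real, Real.norm_eq_abs]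
      refine mul_le_mul (abs_xObs_le hi hj e) ?_ (by positivity) zero_le_one
      calc ∏ l, ‖((((e (w l) * q (w l) : Circle) : ℂ)).re : ℂ)‖ ≤ ∏ _l : Fin 4, (1 : ℝ) :=
            prod_le_prod (fun _ _ => norm_nonneg _) fun l _ => by
              rw [Complex.norm_real, Real.norm_eq_abs]
              exact (Complex.abs_re_le_norm _).trans (le_of_eq (Circle.norm_coe _))
        _ = 1 := by simp
  rw [integral_finsetSum _ fun w _ => hint w]
  -- covering words
  set S : Finset (Fin 4 → LEdge d L a) := univ.filter fun w => ∀ k, ∃ l, w l = pedge hi hj k with hS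
  have hval : ∀ w : Fin 4 → LEdge d L a, T w = if w ∈ S then T (pedge hi hj) else 0 := by
    intro w
    split_ifs with hw
    · -- `w = pedge ∘ σ`
      rw [hS, mem_filter] at hw
      choose g hg using hw.2
      have hginj : Function.Injective g := fun k k' h => hinj (by rw [← hg k, ← hg k', h])
      have hgbij : Function.Bijective g := Finite.injective_iff_bijective.1 hginj
      set σ := Equiv.ofBijective g hgbij with hσ
      have hw' : w = fun l => pedge hi hj (σ.symm l) := by
        funext l
        have : l = g (σ.symm l) := (Equiv.ofBijective_apply_symm_apply g hgbij l).symm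
        conv_lhs => rw [this]
        exact hg _
      rw [hT]
      simp only []
      rw [hw']
      refine integral_congr_ae (Eventually.of_forall fun e => ?_)
      simp only []
      congr 1
      exact Equiv.prod_comp σ.symm (fun k => ((((e (pedge hi hj k) * q (pedge hi hj k) : Circle) : ℂ)).re : ℂ))
    · rw [hS, mem_filter, not_and] at hw
      have hw' := hw (mem_univ _)
      push Not at hw'
      obtain ⟨k, hk⟩ := hw'
      exact integral_xObs_mul_prod_eq_zero_of_miss hi hj hij hL w q hk
  have hsum : ∑ w, T w = (S.card : ℂ) * T (pedge hi hj) := by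
    rw [Finset.sum_congr rfl fun w _ => hval w, Finset.sum_ite_mem, univ_inter, sum_const,
      nsmul_eq_mul]
  -- count: `S` is the image of the permutations
  have hSimg : S = univ.image fun σ : Equiv.Perm (Fin 4) => fun l => pedge hi hj (σ l) := by
    ext w
    rw [hS, mem_filter, mem_image]
    constructor
    · rintro ⟨-, hw⟩
      choose g hg using hw
      have hginj : Function.Injective g := fun k k' h => hinj (by rw [← hg k, ← hg k', h])
      have hgbij : Function.Bijective g := Finite.injective_iff_bijective.1 hginj
      refine ⟨(Equiv.ofBijective g hgbij).symm, mem_univ _, funext fun l => ?_⟩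
      have : l = g ((Equiv.ofBijective g hgbij).symm l) :=
        (Equiv.ofBijective_apply_symm_apply g hgbij l).symm
      conv_rhs => rw [this]
      exact (hg _).symm
    · rintro ⟨σ, -, rfl⟩
      exact ⟨mem_univ _, fun k => ⟨σ.symm k, by simp⟩⟩
  have hcard : S.card = 24 := by
    rw [hSimg, card_image_of_injective _ (fun σ σ' h => Equiv.ext fun l => hinj (congrFun h l)),
      card_univ, Fintype.card_perm, Fintype.card_fin]
    rfl
  have hT0 : T (pedge hi hj) = 16⁻¹ * (xObs hi hj e' : ℂ) := by
    rw [hT]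
    simp only []
    rw [integral_xObs_mul_prod_pedge hi hj hij hL q, hqdef, plaqChar_ratio hi hj v e', xObs,
      Circle.coe_inv_eq_conj, Complex.conj_re]
  show ∑ w, T w = _
  rw [hsum, hcard, hT0]
  push_cast
  ring

include hij in
/-- **THE EIGENVALUE**: `∫ xObs(e) ρ(e, e') de = xObs(e')/16`. [folklore] -/
theorem integral_xObs_mul_rho4 (hL : 2 ≤ L) (e' : LEdge d L a → Circle) :
    ∫ e, (xObs hi hj e : ℂ) * rho4 e e' ∂(Measure.pi fun _ : LEdge d L a => haarProbability Circle) =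
      16⁻¹ * (xObs hi hj e' : ℂ) := by
  -- `∫ xObs K4 = ∫∫ xObs slabCost⁴` by Fubini
  have hK : ∫ e, (xObs hi hj e : ℂ) * K4 e e' ∂(Measure.pi fun _ : LEdge d L a => haarProbability Circle)
      = 24 / 16 * (xObs hi hj e' : ℂ) := by
    have hF : ∀ e, (xObs hi hj e : ℂ) * K4 e e' =
        ∫ v, (xObs hi hj e : ℂ) * ((slabCost e v e' : ℝ) : ℂ) ^ 4
          ∂(Measure.pi fun _ : LSite d L a => haarProbability Circle) := fun e => by
      rw [K4, integral_const_mul]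
    simp_rw [hF]
    have hc : Continuous (Function.uncurry fun (e : LEdge d L a → Circle) (v : LSite d L a → Circle) =>
        (xObs hi hj e : ℂ) * ((slabCost e v e' : ℝ) : ℂ) ^ 4) :=
      ((Complex.continuous_ofReal.comp (continuous_xObs hi hj)).comp continuous_fst).mul
        ((Complex.continuous_ofReal.comp (continuous_slabCost.comp (continuous_fst.prodMk
          (continuous_snd.prodMk continuous_const)))).pow 4)
    have hI : Integrable (Function.uncurry fun (e : LEdge d L a → Circle) (v : LSite d L a → Circle) =>
        (xObs hi hj e : ℂ) * ((slabCost e v e' : ℝ) : ℂ) ^ 4)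
        ((Measure.pi fun _ : LEdge d L a => haarProbability Circle).prod
          (Measure.pi fun _ : LSite d L a => haarProbability Circle)) :=
      Integrable.of_bound hc.aestronglyMeasurable (1 * (Fintype.card (LEdge d L a) : ℝ) ^ 4)
        (Eventually.of_forall fun p => by
          rw [Function.uncurry_apply_pair, norm_mul, norm_pow, Complex.norm_real, Complex.norm_real,
            Real.norm_eq_abs, Real.norm_eq_abs]
          exact mul_le_mul (abs_xObs_le hi hj _) (pow_le_pow_left₀ (abs_nonneg _)
            (abs_slabCost_le _ _ _) 4) (by positivity) zero_le_one)
    rw [integral_integral_swap hI]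
    simp_rw [integral_xObs_mul_slabCost_four hi hj hij hL _ e']
    rw [integral_const, probReal_univ, one_smul]
  -- centring
  have h0 := integral_xObs hi hj hij hL (L := L)
  have hsplit : ∀ e, (xObs hi hj e : ℂ) * rho4 e e' =
      24⁻¹ * ((xObs hi hj e : ℂ) * K4 e e') - (24⁻¹ * c4 d L a) * (xObs hi hj e : ℂ) := by
    intro e; rw [rho4]; ring
  simp_rw [hsplit]
  have hi1 : Integrable (fun e => (xObs hi hj e : ℂ) * K4 e e')
      (Measure.pi fun _ : LEdge d L a => haarProbability Circle) :=
    Integrable.of_bound (((Complex.continuous_ofReal.comp (continuous_xObs hi hj)).measurable.mul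
      (measurable_K4.comp (measurable_id.prodMk measurable_const))).aestronglyMeasurable)
      (1 * (Fintype.card (LEdge d L a) : ℝ) ^ 4) (Eventually.of_forall fun e => by
        rw [norm_mul, Complex.norm_real, Real.norm_eq_abs]
        exact mul_le_mul (abs_xObs_le hi hj e) (norm_K4_le e e') (norm_nonneg _) zero_le_one)
  have hi2 : Integrable (fun e => (xObs hi hj e : ℂ))
      (Measure.pi fun _ : LEdge d L a => haarProbability Circle) :=
    Integrable.of_bound (Complex.continuous_ofReal.comp (continuous_xObs hi hj)).aestronglyMeasurable 1
      (Eventually.of_forall fun e => by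
        rw [Complex.norm_real, Real.norm_eq_abs]; exact abs_xObs_le hi hj e)
  rw [integral_sub (hi1.const_mul _) (hi2.const_mul _), integral_const_mul, integral_const_mul, hK, h0]
  ring

end Eigen

end Summit.Ventures.LatticeQCDFlow.Theory2.Lattice.U1Layer

end
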